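import Summits.CriticalPhenomena.PercolationContinuityZ3.Theorems.PercNearOneGluingNoHeavyLowerTailSahiCombMixCoinTransfer
import Summits.CriticalPhenomena.PercolationContinuityZ3.Theorems.PercNearOneGluingNoHeavyLowerTailSahiMixtureMixedThree

/-!
# The comb (tensor-Bernstein) hierarchy for Sahi's `E_k`, XLIX: MIXED one-coordinate steps on the cube — the transfer lemma and the three comb cells
# over a triple

Support file of the one-cut programme (crux `NoHeavyLowerTail`, stmt-CriticalPhenomena-4575; cell `prim-masterthm`, seat P3, gen 9;
`run/shared/lean/prim/prim-masterthm/prim-masterthm-p3/HIERARCHY.md` §17).  Vocabulary: `mixCoord`, `ex_ind_mixCoord`, `CombHereditary.row_off` (`…SahiCombMixCoord`),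
`finsetProd_ind_eq_ind_biInter` (`…SahiCombMixCoinTransfer`), the law-level mixed cells `SahiMixture.sahiE_three_orAndId/orAndAnd/orOrAnd_eq`
(`…SahiMixtureMixedThree`).

A MIXED STEP at the coordinate `e` ORs `{e ∈ ω}` into the members selected by `G₁` and ANDs it into the members selected by `G₂` (OR wins on overlap):
`orAndCoord U e G₁ G₂`; law side `orAndCoin A b₁ b₂` (same coin).  A monotone read-once DECISION LIST is exactly a sequence of such steps.
* **`sahiE_orAndCoord_eq_coin`** — THE MIXED TRANSFER (every `n`, every `G₁, G₂`): for events ignoring `e`,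
  `E_n(μ_p; orAndCoord U e G₁ G₂) = E_n(μ_p ⊗ coin(p_e); (orAndCoin U_j (G₁ j) (G₂ j))_j)` (block moments `ex_prod_ind_orAndCoord` / `ex_prod_ind_orAndCoin`:
  `p_e·μ_p(U_{S∖G₁}) + [no AND-member in S]·(1−p_e)·μ_p(U_S)`).
* **`combPos_three_orAndId`, `combPos_three_orAndAnd`, `combPos_three_orOrAnd`** — for THREE events ignoring `e` with `CombHereditary U` the cubic rows of
  `(U_0∪[e], U_1∩[e], U_2)`, `(U_0∪[e], U_1∩[e], U_2∩[e])`, `(U_0∪[e], U_1∪[e], U_2∩[e])` are comb-positive at multidegree `3` (transfer + the closed identities,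
  every piece a product of a hereditary comb row / Venn moment off `e` with a coordinate power).
The step and closure theorems (all triples of common-order monotone decision lists are `CombHereditary`) are in `…SahiCombMixMixedThree`.
HONEST FRAMING: nothing here asserts (M⁺-k) or `C_k` for `k ≥ 3`. [this work]
-/

noncomputable section

open scoped Classical

namespace Summit.CriticalPhenomena.PercolationContinuityZ3.Theorems

open Finset Function
open Literature.Combinatorics.Sahi2008
open Literature.Probability.Percolation.BHK2006 (ind_le_one ind_inter)
open Literature.Probability.Percolation.DecisionTree (ind ind_of_mem ind_of_not_mem ind_nonneg)
open SahiComb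
open SahiCombDisjunct (orCoord)
open SahiCombHereditary (CombHereditary)
open SahiMixture (coinWeight orCoin andCoin)

variable {ι : Type} [Fintype ι]

namespace SahiCombMix

/-! ### Mixed steps: definitions and block moments -/

/-- **Mixed step on the cube**: OR `{e∈ω}` into the members with `G₁ j`, AND it into the members with `G₂ j` (OR wins on overlap). [this work] -/
def orAndCoord {n : ℕ} (U : Fin n → Set (Set ι)) (e : ι) (G₁ G₂ : Fin n → Bool) : Fin n → Set (Set ι) :=
  fun j => bif G₁ j then U j ∪ {ω : Set ι | e ∈ ω} else bif G₂ j then U j ∩ {ω : Set ι | e ∈ ω} else U j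

/-- **Mixed step, law side**: the same with an external coin (`orCoin A true` / `andCoin A true` / untouched `orCoin A false`). [this work] -/
def orAndCoin {α : Type*} (A : Set α) (b₁ b₂ : Bool) : Set (α × Bool) :=
  bif b₁ then orCoin A true else bif b₂ then andCoin A true else orCoin A false

omit [Fintype ι] in
/-- Sections commute with finite intersections. [folklore] -/
theorem secAt_biInter_eq {n : ℕ} (V : Fin n → Set (Set ι)) (e : ι) (b : Bool) (S : Finset (Fin n)) :
    secAt e b (⋂ i ∈ S, V i) = ⋂ i ∈ S, secAt e b (V i) := by
  induction S using Finset.induction_on with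
  | empty => ext ω; simp [mem_secAt]
  | insert a S ha ih => rw [Finset.set_biInter_insert, Finset.set_biInter_insert, secAt_inter, ih]

omit [Fintype ι] in
/-- Sections of a mixed member: on `e` it is `Ω` (OR) or `U_j`; off `e` it is `U_j` (OR / untouched) or `∅` (AND). [this work] -/
theorem secAt_orAndCoord {n : ℕ} (U : Fin n → Set (Set ι)) (e : ι) (G₁ G₂ : Fin n → Bool)
    (hUe : ∀ (j : Fin n) (b : Bool), secAt e b (U j) = U j) (j : Fin n) :
    secAt e true (orAndCoord U e G₁ G₂ j) = (bif G₁ j then Set.univ else U j) ∧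
      secAt e false (orAndCoord U e G₁ G₂ j) = (bif G₁ j then U j else bif G₂ j then ∅ else U j) := by
  unfold orAndCoord
  cases G₁ j <;> cases G₂ j <;>
    simp [SahiCombDisjunct.secAt_union, secAt_inter, SahiCombDisjunct.secAt_true_coord, SahiCombDisjunct.secAt_false_coord, hUe]

/-- **Cube side**: mixed block moments
`μ_p(⋂_{i∈S} V_i) = p_e·μ_p(⋂_{i∈S, ¬G₁ i} U_i) + (1−p_e)·[∀ i∈S, G₁ i ∨ ¬G₂ i]·μ_p(⋂_{i∈S} U_i)`. [this work] -/
theorem ex_prod_ind_orAndCoord {n : ℕ} (U : Fin n → Set (Set ι)) (e : ι) (G₁ G₂ : Fin n → Bool)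
    (hUe : ∀ (j : Fin n) (b : Bool), secAt e b (U j) = U j) (p : ι → unitInterval) (S : Finset (Fin n)) :
    ex (bernoulliWeight p) (∏ i ∈ S, ind (orAndCoord U e G₁ G₂ i))
      = (p e : ℝ) * ex (bernoulliWeight p) (ind (⋂ i ∈ S.filter (fun i => G₁ i = false), U i))
        + (1 - (p e : ℝ)) * (if ∀ i ∈ S, G₁ i = true ∨ G₂ i = false then ex (bernoulliWeight p) (ind (⋂ i ∈ S, U i)) else 0) := by
  rw [finsetProd_ind_eq_ind_biInter]
  have h1 : secAt e true (⋂ i ∈ S, orAndCoord U e G₁ G₂ i) = ⋂ i ∈ S.filter (fun i => G₁ i = false), U i := by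
    rw [secAt_biInter_eq]
    ext ω
    simp only [Set.mem_iInter, Finset.mem_filter, (secAt_orAndCoord U e G₁ G₂ hUe _).1]
    constructor
    · rintro h i ⟨hi, hG⟩; have := h i hi; rw [hG] at this; exact this
    · intro h i hi
      cases hG : G₁ i
      · exact h i ⟨hi, hG⟩
      · exact Set.mem_univ ω
  by_cases hS : ∀ i ∈ S, G₁ i = true ∨ G₂ i = false
  · have h0 : secAt e false (⋂ i ∈ S, orAndCoord U e G₁ G₂ i) = ⋂ i ∈ S, U i := by
      rw [secAt_biInter_eq]
      refine Set.iInter_congr fun i => Set.iInter_congr fun hi => ?_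
      rw [(secAt_orAndCoord U e G₁ G₂ hUe i).2]
      rcases hS i hi with h | h
      · rw [h]; rfl
      · rw [h]; cases G₁ i <;> rfl
    rw [if_pos hS, SahiCombDisjunct.ex_ind_of_secAt p e h1 h0]
  · have h0 : secAt e false (⋂ i ∈ S, orAndCoord U e G₁ G₂ i) = ∅ := by
      rw [secAt_biInter_eq]
      simp only [not_forall, not_or] at hS
      obtain ⟨i, hi, hG1, hG2⟩ := hS
      have hG1' : G₁ i = false := by simpa using hG1
      have hG2' : G₂ i = true := by simpa using hG2
      refine Set.eq_empty_of_subset_empty fun ω hω => ?_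
      have := Set.mem_iInter₂.1 hω i hi
      rw [(secAt_orAndCoord U e G₁ G₂ hUe i).2, hG1', hG2'] at this
      simp at this
    have hz : ind (∅ : Set (Set ι)) = 0 := funext fun ω => ind_of_not_mem (Set.notMem_empty ω)
    rw [if_neg hS, SahiCombDisjunct.ex_ind_of_secAt p e h1 h0, hz, SahiMixture.ex_zero_fun]

/-- **Coin side**: the same block moments for an external coin of bias `h`. [this work] -/
theorem ex_prod_ind_orAndCoin {α : Type*} [Fintype α] (μ : α → ℝ) (h : ℝ) {n : ℕ} (A : Fin n → Set α) (G₁ G₂ : Fin n → Bool)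
    (S : Finset (Fin n)) :
    ex (coinWeight μ h) (∏ i ∈ S, ind (orAndCoin (A i) (G₁ i) (G₂ i)))
      = h * ex μ (ind (⋂ i ∈ S.filter (fun i => G₁ i = false), A i))
        + (1 - h) * (if ∀ i ∈ S, G₁ i = true ∨ G₂ i = false then ex μ (ind (⋂ i ∈ S, A i)) else 0) := by
  rw [SahiMixture.ex_coinWeight, add_comm]
  have e1 : (fun a => (∏ i ∈ S, ind (orAndCoin (A i) (G₁ i) (G₂ i))) (a, true)) = ind (⋂ i ∈ S.filter (fun i => G₁ i = false), A i) := by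
    rw [← finsetProd_ind_eq_ind_biInter]
    funext a
    rw [Finset.prod_apply, Finset.prod_apply, Finset.prod_filter]
    refine Finset.prod_congr rfl fun i _ => ?_
    unfold orAndCoin
    cases G₁ i <;> cases G₂ i <;> simp
  have e0 : ex μ (fun a => (∏ i ∈ S, ind (orAndCoin (A i) (G₁ i) (G₂ i))) (a, false))
      = if ∀ i ∈ S, G₁ i = true ∨ G₂ i = false then ex μ (ind (⋂ i ∈ S, A i)) else 0 := by
    by_cases hS : ∀ i ∈ S, G₁ i = true ∨ G₂ i = false
    · rw [if_pos hS, ← finsetProd_ind_eq_ind_biInter]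
      congr 1; funext a
      rw [Finset.prod_apply, Finset.prod_apply]
      refine Finset.prod_congr rfl fun i hi => ?_
      unfold orAndCoin
      rcases hS i hi with hG | hG <;> rw [hG] <;> cases G₁ i <;> simp
    · rw [if_neg hS]
      simp only [not_forall, not_or] at hS
      obtain ⟨i, hi, hG1, hG2⟩ := hS
      have hG1' : G₁ i = false := by simpa using hG1
      have hG2' : G₂ i = true := by simpa using hG2
      have hz : (fun a => (∏ i ∈ S, ind (orAndCoin (A i) (G₁ i) (G₂ i))) (a, false)) = 0 := by
        funext a
        rw [Finset.prod_apply]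
        refine Finset.prod_eq_zero hi ?_
        unfold orAndCoin
        rw [hG1', hG2']; simp
      rw [hz, SahiMixture.ex_zero_fun]
  rw [e1, e0]

/-- **THE MIXED CUBE ↔ COIN TRANSFER** (every `n`, `G₁`, `G₂`). [this work] -/
theorem sahiE_orAndCoord_eq_coin {n : ℕ} (U : Fin n → Set (Set ι)) (e : ι) (G₁ G₂ : Fin n → Bool)
    (hUe : ∀ (j : Fin n) (b : Bool), secAt e b (U j) = U j) (p : ι → unitInterval) :
    sahiE (bernoulliWeight p) n (fun j => ind (orAndCoord U e G₁ G₂ j))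
      = sahiE (coinWeight (bernoulliWeight p) (p e)) n (fun j => ind (orAndCoin (U j) (G₁ j) (G₂ j))) :=
  sahiE_congr_of_moments _ _ n _ _ fun S _ => by
    rw [ex_prod_ind_orAndCoord U e G₁ G₂ hUe p S, ex_prod_ind_orAndCoin]

/-! ### The three mixed comb cells over a triple -/

section Three

variable (U : Fin 3 → Set (Set ι)) (e : ι) (hUe : ∀ (j : Fin 3) (b : Bool), secAt e b (U j) = U j) (hU : CombHereditary U)
include hUe hU

omit hU in
/-- `μ_p(U_j)`, comb degree `1` off `e`. [this work] -/
theorem combPos_ex_U3 (j : Fin 3) : CombPos (update (fun _ : ι => 1) e 0) (fun p => ex (bernoulliWeight p) (ind (U j))) :=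
  (combPos_ex_ind (U j)).of_ignores e fun p s => by
    rw [← hUe j true]; exact SahiCombDisjunct.ex_update_of_ignores' e (fun ω => ind_secAt_insert e true (U j) ω) p s

omit hU in
/-- `a − μ_p(U_j)` for `a ≥ 1`, comb degree `1` off `e`. [this work] -/
theorem combPos_const_sub_ex_U3 (j : Fin 3) {a : ℝ} (ha : 1 ≤ a) :
    CombPos (update (fun _ : ι => 1) e 0) (fun p => a - ex (bernoulliWeight p) (ind (U j))) :=
  (combPos_const_sub_ex (h := ind (U j)) fun ω => (ind_le_one (U j) ω).trans ha).of_ignores e fun p s => by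
    rw [← hUe j true, SahiCombDisjunct.ex_update_of_ignores' e (fun ω => ind_secAt_insert e true (U j) ω) p s]

omit hU in
/-- `μ_p(U_k ∖ U_j) = μ_p(U_k) − μ_p(U_j U_k)`, comb degree `1` off `e`. [this work] -/
theorem combPos_diff_U3 (j k : Fin 3) :
    CombPos (update (fun _ : ι => 1) e 0) (fun p => ex (bernoulliWeight p) (ind (U k)) - ex (bernoulliWeight p) (ind (U j) * ind (U k))) := by
  have hI : ∀ (i : Fin 3) (ω : Set ι), ind (U i) (insert e ω) = ind (U i) ω := fun i ω => by
    rw [← hUe i true]; exact ind_secAt_insert e true (U i) ω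
  have h0 := (combPos_ex (ι := ι) (h := fun ω => (1 - ind (U j) ω) * ind (U k) ω) fun ω =>
      mul_nonneg (sub_nonneg.2 (ind_le_one (U j) ω)) (ind_nonneg (U k) ω)).of_ignores e
    fun p s => SahiCombDisjunct.ex_update_of_ignores' e (fun ω => by
      show (1 - ind (U j) (insert e ω)) * ind (U k) (insert e ω) = (1 - ind (U j) ω) * ind (U k) ω
      rw [hI, hI]) p s
  refine h0.congr fun p => ?_
  have ee := SahiMixture.ex_eq_lin (bernoulliWeight p) (fun ω => (1 - ind (U j) ω) * ind (U k) ω) ![1, -1]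
    ![ind (U k), ind (U j) * ind (U k)] (fun ω => by simp [Fin.sum_univ_succ]; ring)
  simp only [Fin.sum_univ_succ, Fin.sum_univ_zero, Matrix.cons_val_zero, Matrix.cons_val_succ] at ee
  rw [ee]; ring

/-- `Cov_p(U_j, U_k)` as a hereditary comb row, degree `2` off `e`. [this work] -/
theorem combPos_cov_U3 (j k : Fin 3) :
    CombPos (update (fun _ : ι => 2) e 0) (fun p => ex (bernoulliWeight p) (ind (U j) * ind (U k))
      - ex (bernoulliWeight p) (ind (U j)) * ex (bernoulliWeight p) (ind (U k))) := by
  have r2 := hU.row_off e hUe 2 ![({j} : Finset (Fin 3)), {k}]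
  have eC : (fun l => ind (⋂ i ∈ (![({j} : Finset (Fin 3)), {k}] : Fin 2 → Finset (Fin 3)) l, U i)) = ![ind (U j), ind (U k)] := by
    funext l; fin_cases l <;> simp
  rw [eC] at r2
  refine r2.congr fun p => ?_
  rw [sahiE_two_apply]
  simp only [Matrix.cons_val_zero, Matrix.cons_val_one]

omit [Fintype ι] hUe hU in
/-- Degree bookkeeping along `e` for cubic cells. [folklore] -/
theorem deg3_single_add (k : ℕ) (hk : k ≤ 3) : (Pi.single e k + update (fun _ : ι => 3) e 0) ≤ fun _ : ι => 3 := fun x => by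
  by_cases hx : x = e
  · subst hx; simp [hk]
  · simp [hx]

/-- **Comb cell M1**: the cubic row of `(U_0 ∪ [e], U_1 ∩ [e], U_2)` is comb-positive at multidegree `3`. [this work] -/
theorem combPos_three_orAndId :
    CombPos (fun _ : ι => 3) (fun p => sahiE (bernoulliWeight p) 3
      (fun j => ind (orAndCoord U e (![true, false, false] : Fin 3 → Bool) (![false, true, false] : Fin 3 → Bool) j))) := by
  have hC := combPos_cov_U3 U e hUe hU 1 2
  have hX : CombPos (update (fun _ : ι => 3) e 0) (fun p =>
      (2 - ex (bernoulliWeight p) (ind (U 0))) * (ex (bernoulliWeight p) (ind (U 1) * ind (U 2))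
          - ex (bernoulliWeight p) (ind (U 1)) * ex (bernoulliWeight p) (ind (U 2)))
        + ex (bernoulliWeight p) (ind (U 1)) * (ex (bernoulliWeight p) (ind (U 2)) - ex (bernoulliWeight p) (ind (U 0) * ind (U 2)))) :=
    (combPos_mono12 e (combPos_const_sub_ex_U3 U e hUe 0 (by norm_num)) hC).add
      ((combPos_mono2 e (combPos_ex_U3 U e hUe 1) (combPos_diff_U3 U e hUe 0 2)).mono (deg_off_mono e (by norm_num)))
  have s2 := (SahiCombDisjunct.combPos_coord_pow e 2 0).mul_of_le (hC.mono (deg_off_mono e (show 2 ≤ 3 by norm_num)))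
    (deg3_single_add e 2 (by norm_num))
  have s1 := (SahiCombDisjunct.combPos_coord_pow e 1 1).mul_of_le hX (deg3_single_add e 2 (by norm_num))
  have efam : (fun j => ind (orAndCoin (U j) ((![true, false, false] : Fin 3 → Bool) j) ((![false, true, false] : Fin 3 → Bool) j)))
      = ![ind (orCoin (U 0) true), ind (andCoin (U 1) true), ind (orCoin (U 2) false)] := by
    funext j; fin_cases j <;> rfl
  refine (s2.add s1).congr fun p => ?_
  rw [sahiE_orAndCoord_eq_coin U e _ _ hUe p, efam, SahiMixture.sahiE_three_orAndId_eq (sum_bernoulliWeight p) (U 0) (U 1) (U 2) (p e : ℝ)]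
  ring

/-- **Comb cell M2**: the cubic row of `(U_0 ∪ [e], U_1 ∩ [e], U_2 ∩ [e])` is comb-positive at multidegree `3`. [this work] -/
theorem combPos_three_orAndAnd :
    CombPos (fun _ : ι => 3) (fun p => sahiE (bernoulliWeight p) 3
      (fun j => ind (orAndCoord U e (![true, false, false] : Fin 3 → Bool) (![false, true, true] : Fin 3 → Bool) j))) := by
  have hC := combPos_cov_U3 U e hUe hU 1 2
  have hBC := combPos_mono2 e (combPos_ex_U3 U e hUe 1) (combPos_ex_U3 U e hUe 2)
  have hX : CombPos (update (fun _ : ι => 3) e 0) (fun p =>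
      (3 - ex (bernoulliWeight p) (ind (U 0))) * (ex (bernoulliWeight p) (ind (U 1) * ind (U 2))
          - ex (bernoulliWeight p) (ind (U 1)) * ex (bernoulliWeight p) (ind (U 2)))
        + ex (bernoulliWeight p) (ind (U 1)) * ex (bernoulliWeight p) (ind (U 2))) :=
    (combPos_mono12 e (combPos_const_sub_ex_U3 U e hUe 0 (by norm_num)) hC).add (hBC.mono (deg_off_mono e (by norm_num)))
  have hY : CombPos (update (fun _ : ι => 3) e 0) (fun p =>
      (2 - ex (bernoulliWeight p) (ind (U 0))) * (ex (bernoulliWeight p) (ind (U 1) * ind (U 2))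
          - ex (bernoulliWeight p) (ind (U 1)) * ex (bernoulliWeight p) (ind (U 2)))
        + (2 - ex (bernoulliWeight p) (ind (U 0))) * (ex (bernoulliWeight p) (ind (U 1)) * ex (bernoulliWeight p) (ind (U 2)))) :=
    (combPos_mono12 e (combPos_const_sub_ex_U3 U e hUe 0 (by norm_num)) hC).add
      (combPos_mono12 e (combPos_const_sub_ex_U3 U e hUe 0 (by norm_num)) hBC)
  have s3 := (SahiCombDisjunct.combPos_coord_pow e 3 0).mul_of_le (hC.mono (deg_off_mono e (show 2 ≤ 3 by norm_num)))
    (deg3_single_add e 3 (by norm_num))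
  have s2 := (SahiCombDisjunct.combPos_coord_pow e 2 1).mul_of_le hX (deg3_single_add e 3 (by norm_num))
  have s1 := (SahiCombDisjunct.combPos_coord_pow e 1 2).mul_of_le hY (deg3_single_add e 3 (by norm_num))
  have efam : (fun j => ind (orAndCoin (U j) ((![true, false, false] : Fin 3 → Bool) j) ((![false, true, true] : Fin 3 → Bool) j)))
      = ![ind (orCoin (U 0) true), ind (andCoin (U 1) true), ind (andCoin (U 2) true)] := by
    funext j; fin_cases j <;> rfl
  refine ((s3.add s2).add s1).congr fun p => ?_
  rw [sahiE_orAndCoord_eq_coin U e _ _ hUe p, efam, SahiMixture.sahiE_three_orAndAnd_eq (sum_bernoulliWeight p) (U 0) (U 1) (U 2) (p e : ℝ)]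
  ring

omit hU in
/-- **Comb cell M3**: the cubic row of `(U_0 ∪ [e], U_1 ∪ [e], U_2 ∩ [e])` is comb-positive at multidegree `3` — for ANY three events ignoring `e`
(no positivity hypothesis). [this work] -/
theorem combPos_three_orOrAnd :
    CombPos (fun _ : ι => 3) (fun p => sahiE (bernoulliWeight p) 3
      (fun j => ind (orAndCoord U e (![true, true, false] : Fin 3 → Bool) (![false, false, true] : Fin 3 → Bool) j))) := by
  -- the bracket `Ea(1 − Eb) + (Eb − Eab) + c·(1−Ea)(1−Eb)`, all degree ≤ 2 off `e`
  have hA1B := combPos_mono2 e (combPos_ex_U3 U e hUe 0) (combPos_const_sub_ex_U3 U e hUe 1 le_rfl)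
  have hD := (combPos_diff_U3 U e hUe 0 1).mono (deg_off_mono e (show 1 ≤ 2 by norm_num))
  have hN := combPos_mono2 e (combPos_const_sub_ex_U3 U e hUe 0 le_rfl) (combPos_const_sub_ex_U3 U e hUe 1 le_rfl)
  have hc := combPos_ex_U3 U e hUe 2
  have hX : CombPos (update (fun _ : ι => 3) e 0) (fun p => ex (bernoulliWeight p) (ind (U 2)) *
      (ex (bernoulliWeight p) (ind (U 0)) + ex (bernoulliWeight p) (ind (U 1)) - ex (bernoulliWeight p) (ind (U 0) * ind (U 1))
        - ex (bernoulliWeight p) (ind (U 0)) * ex (bernoulliWeight p) (ind (U 1))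
        + (1 - ex (bernoulliWeight p) (ind (U 0))) * (1 - ex (bernoulliWeight p) (ind (U 1))))) :=
    (combPos_mono12 e hc ((hA1B.add hD).add hN)).congr fun p => by ring
  have hY : CombPos (update (fun _ : ι => 3) e 0) (fun p => ex (bernoulliWeight p) (ind (U 2)) *
      (ex (bernoulliWeight p) (ind (U 0)) + ex (bernoulliWeight p) (ind (U 1)) - ex (bernoulliWeight p) (ind (U 0) * ind (U 1))
        - ex (bernoulliWeight p) (ind (U 0)) * ex (bernoulliWeight p) (ind (U 1))
        + 2 * ((1 - ex (bernoulliWeight p) (ind (U 0))) * (1 - ex (bernoulliWeight p) (ind (U 1)))))) :=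
    (combPos_mono12 e hc ((hA1B.add hD).add (hN.smul (by norm_num : (0:ℝ) ≤ 2)))).congr fun p => by ring
  have s2 := (SahiCombDisjunct.combPos_coord_pow e 2 1).mul_of_le hX (deg3_single_add e 3 (by norm_num))
  have s1 := (SahiCombDisjunct.combPos_coord_pow e 1 2).mul_of_le hY (deg3_single_add e 3 (by norm_num))
  have efam : (fun j => ind (orAndCoin (U j) ((![true, true, false] : Fin 3 → Bool) j) ((![false, false, true] : Fin 3 → Bool) j)))
      = ![ind (orCoin (U 0) true), ind (orCoin (U 1) true), ind (andCoin (U 2) true)] := by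
    funext j; fin_cases j <;> rfl
  refine (s2.add s1).congr fun p => ?_
  rw [sahiE_orAndCoord_eq_coin U e _ _ hUe p, efam, SahiMixture.sahiE_three_orOrAnd_eq (sum_bernoulliWeight p) (U 0) (U 1) (U 2) (p e : ℝ)]
  ring

end Three

end SahiCombMix

end Summit.CriticalPhenomena.PercolationContinuityZ3.Theorems

end
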